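import Literature.MathematicalPhysics.KineticTheory.InfiniteChainSuperstableEstimates
import HarnessLib

/-!
# Superstable states of the chain are logarithmically tempered

Topic `Literature/MathematicalPhysics/KineticTheory`; proofs-only companion of
`InfiniteChainSuperstableDynamics.lean` (no definition, no named fact). Setting of P. Buttà,
C. Marchioro, J. Stat. Phys. **164** (2016) 680–692 (arXiv:1602.01294), §2, `d = ν = 1`: the chain
`P : OscillatorChain` with non-negative `U`, `V`, BM's local energies `W_{μ,k}` (2.4), growth
functional `Q` (2.5), good set `𝒳₀ = {Q < ∞}` (`bmGood`), superstability estimate (2.3)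
(`HasSuperstabilityEstimate`), and BM's (2.6) `ω(𝒳₀ᶜ) = 0` (in tree:
`ButtaMarchioro2016_eq26_chain_holds`).

Content: the elementary consequence of BM (3.7) (`bmLocalEnergy_le`, tree) with `k = 0`,
"a configuration of `𝒳₀` has site energies of at most LOGARITHMIC growth",
`p_x²/2 + U(q_x) + 1 ≤ Q(σ) (2 log(e+|x|) + 3)` (`siteEnergy_le_of_mem_bmGood`); with the coercivity
of an even polynomial `U` of degree `2s₁`, `(1+|q_x|)^{2s₁} ≤ C Q(σ)(2log(e+|x|)+3)`
(`one_add_abs_pow_le_of_mem_bmGood`); hence **every state with the superstability estimate (2.3) is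
carried by logarithmically tempered configurations** (`ae_logTempered_of_hasSuperstabilityEstimate`),
in particular by Ruelle/Lanford–Lebowitz–Lieb tempered ones (linear growth of `|q_x|`, the growth
class of LLL 1977 Thm 4 for the quartic chain; `ae_abs_fst_le_linear_of_hasSuperstabilityEstimate`),
and the instance for the tree's pinned quartic chain (`…_pinnedChain`). This is the inclusion
"regular (BM-superstable) states ⊆ tempered states" used when DLR uniqueness is stated in a
tempered class (Cassandro–Olivieri–Pellegrinotti–Presutti 1978 / Lanford–Lebowitz–Lieb 1977 (18))
rather than in the superstable class, e.g. in the witness-regularisation seam of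
`Summit.AtomisticToContinuum.FouriersLaw` (crux `GreenKuboContinuation`). All statements are
folklore-level consequences of BM (3.7) and (2.6).
-/

noncomputable section

open MeasureTheory Filter Set
open scoped Topology ENNReal

namespace Literature.MathematicalPhysics.KineticTheory.HeatConduction

namespace OscillatorChain

variable {P : OscillatorChain}

/-- **Logarithmic growth of the site energies on `𝒳₀`** (BM (3.7) with `k = 0`): for
`σ ∈ 𝒳₀` and every site `x`, `p_x²/2 + U(q_x) + 1 ≤ Q(σ)(2 log(e+|x|) + 3)` (`U, V ≥ 0`).
[cite: ButtaMarchioro2016, §3 eq. (3.7)] -/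
theorem siteEnergy_le_of_mem_bmGood (hU0 : ∀ r, 0 ≤ P.U r) (hV0 : ∀ r, 0 ≤ P.V r)
    {σ : ChainConfig} (hσ : σ ∈ P.bmGood) (x : ℤ) :
    (σ x).2 ^ 2 / 2 + P.U (σ x).1 + 1 ≤
      P.bmGrowth σ * (2 * Real.log (Real.exp 1 + |(x : ℝ)|) + 3) := by
  have h1 : (σ x).2 ^ 2 / 2 + P.U (σ x).1 + 1 ≤ P.bmLocalEnergy x 0 σ :=
    site_le_bmLocalEnergy hU0 hV0 σ (mem_cbox_self x 0)
  have h2 := bmLocalEnergy_le hU0 hV0 hσ x 0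
  simp only [Nat.cast_zero, mul_zero, zero_add] at h2
  exact h1.trans h2

/-- Momenta grow at most like `√log` on `𝒳₀`: `p_x² ≤ 2 Q(σ)(2 log(e+|x|) + 3)`. [folklore] -/
theorem sq_snd_le_of_mem_bmGood (hU0 : ∀ r, 0 ≤ P.U r) (hV0 : ∀ r, 0 ≤ P.V r)
    {σ : ChainConfig} (hσ : σ ∈ P.bmGood) (x : ℤ) :
    (σ x).2 ^ 2 ≤ 2 * (P.bmGrowth σ * (2 * Real.log (Real.exp 1 + |(x : ℝ)|) + 3)) := by
  have h := siteEnergy_le_of_mem_bmGood hU0 hV0 hσ x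
  have hU := hU0 (σ x).1
  linarith

/-- **Logarithmic growth of the positions on `𝒳₀`** for an even polynomial pinning of degree
`2s₁ ≥ 2`: `(1 + |q_x|)^{2s₁} ≤ C Q(σ)(2 log(e+|x|) + 3)`, `C` depending on `U` only. [folklore] -/
theorem one_add_abs_pow_le_of_mem_bmGood {s₁ : ℕ} (hs₁ : 1 ≤ s₁) (hU : IsEvenPolyOfDegree P.U s₁)
    (hV0 : ∀ r, 0 ≤ P.V r) :
    ∃ C : ℝ, 1 ≤ C ∧ ∀ σ ∈ P.bmGood, ∀ x : ℤ,
      (1 + |(σ x).1|) ^ (2 * s₁) ≤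
        C * (P.bmGrowth σ * (2 * Real.log (Real.exp 1 + |(x : ℝ)|) + 3)) := by
  obtain ⟨C, hC1, hC⟩ := hU.exists_one_add_abs_pow_le hs₁
  have hU0 : ∀ r, 0 ≤ P.U r := by obtain ⟨_, -, -, h⟩ := hU; exact h
  refine ⟨C, hC1, fun σ hσ x => ?_⟩
  have h := siteEnergy_le_of_mem_bmGood hU0 hV0 hσ x
  have hp : 0 ≤ (σ x).2 ^ 2 / 2 := by positivity
  calc (1 + |(σ x).1|) ^ (2 * s₁) ≤ C * (P.U (σ x).1 + 1) := hC _
    _ ≤ C * (P.bmGrowth σ * (2 * Real.log (Real.exp 1 + |(x : ℝ)|) + 3)) :=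
        mul_le_mul_of_nonneg_left (by linarith) (zero_le_one.trans hC1)

/-- `2 log(e+|x|) + 3 ≤ 5 log(e+|x|)` (since `log(e+|x|) ≥ 1`). [folklore] -/
theorem two_mul_log_add_three_le (x : ℤ) :
    2 * Real.log (Real.exp 1 + |(x : ℝ)|) + 3 ≤ 5 * Real.log (Real.exp 1 + |(x : ℝ)|) := by
  have := one_le_log_exp_add_abs x
  linarith

/-- **Superstable states are logarithmically tempered.** If `U`, `V` are even non-negative
polynomials (`deg U = 2s₁ ≥ 2`, `deg V = 2s₂ ≥ 2`) and the state `ω` satisfies BM's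
superstability estimate (2.3), then `ω`-almost every configuration has site energies, squared
momenta and `(1+|q_x|)^{2s₁}` all bounded by `C_σ log(e + |x|)` for all sites `x` (BM (2.6):
`ω(𝒳₀) = 1`, and the logarithmic bounds on `𝒳₀`). [cite: ButtaMarchioro2016, §2 eq. (2.6)] -/
theorem ae_logTempered_of_hasSuperstabilityEstimate {s₁ s₂ : ℕ} (hs₁ : 1 ≤ s₁) (hs₂ : 1 ≤ s₂)
    (hU : IsEvenPolyOfDegree P.U s₁) (hV : IsEvenPolyOfDegree P.V s₂) {ω : Measure ChainConfig}
    (hω : P.HasSuperstabilityEstimate ω) :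
    ∀ᵐ σ ∂ω, ∃ C : ℝ, 0 ≤ C ∧ ∀ x : ℤ,
      (σ x).2 ^ 2 / 2 + P.U (σ x).1 + 1 ≤ C * Real.log (Real.exp 1 + |(x : ℝ)|) ∧
      (1 + |(σ x).1|) ^ (2 * s₁) ≤ C * Real.log (Real.exp 1 + |(x : ℝ)|) := by
  have hU0 : ∀ r, 0 ≤ P.U r := by obtain ⟨_, -, -, h⟩ := hU; exact h
  have hV0 : ∀ r, 0 ≤ P.V r := by obtain ⟨_, -, -, h⟩ := hV; exact h
  have hnull : ω (P.bmGood)ᶜ = 0 := (ButtaMarchioro2016_eq26_chain_holds P s₁ s₂ hs₁ hs₂ hU hV ω hω).2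
  have hae : ∀ᵐ σ ∂ω, σ ∈ P.bmGood := by
    rw [ae_iff]
    exact hnull
  obtain ⟨C, hC1, hC⟩ := one_add_abs_pow_le_of_mem_bmGood hs₁ hU hV0
  filter_upwards [hae] with σ hσ
  have hQ1 : 1 ≤ P.bmGrowth σ := one_le_bmGrowth hU0 hV0 hσ
  have hQ0 : 0 ≤ P.bmGrowth σ := zero_le_one.trans hQ1
  refine ⟨5 * C * P.bmGrowth σ, by positivity, fun x => ⟨?_, ?_⟩⟩
  · have h := siteEnergy_le_of_mem_bmGood hU0 hV0 hσ x
    have hl := two_mul_log_add_three_le x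
    have hlog0 : 0 ≤ Real.log (Real.exp 1 + |(x : ℝ)|) := zero_le_one.trans (one_le_log_exp_add_abs x)
    calc (σ x).2 ^ 2 / 2 + P.U (σ x).1 + 1
        ≤ P.bmGrowth σ * (2 * Real.log (Real.exp 1 + |(x : ℝ)|) + 3) := h
      _ ≤ P.bmGrowth σ * (5 * Real.log (Real.exp 1 + |(x : ℝ)|)) :=
          mul_le_mul_of_nonneg_left hl hQ0
      _ = 1 * P.bmGrowth σ * (5 * Real.log (Real.exp 1 + |(x : ℝ)|)) := by ring
      _ ≤ C * P.bmGrowth σ * (5 * Real.log (Real.exp 1 + |(x : ℝ)|)) := by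
          gcongr
      _ = 5 * C * P.bmGrowth σ * Real.log (Real.exp 1 + |(x : ℝ)|) := by ring
  · have h := hC σ hσ x
    have hl := two_mul_log_add_three_le x
    have hC0 : 0 ≤ C := zero_le_one.trans hC1
    calc (1 + |(σ x).1|) ^ (2 * s₁)
        ≤ C * (P.bmGrowth σ * (2 * Real.log (Real.exp 1 + |(x : ℝ)|) + 3)) := h
      _ ≤ C * (P.bmGrowth σ * (5 * Real.log (Real.exp 1 + |(x : ℝ)|))) :=
          mul_le_mul_of_nonneg_left (mul_le_mul_of_nonneg_left hl hQ0) hC0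
      _ = 5 * C * P.bmGrowth σ * Real.log (Real.exp 1 + |(x : ℝ)|) := by ring

/-- `log(e + |x|) ≤ 1 + |x|`. [folklore] -/
theorem log_exp_add_abs_le (x : ℤ) : Real.log (Real.exp 1 + |(x : ℝ)|) ≤ 1 + |(x : ℝ)| := by
  have hpos : 0 < Real.exp 1 + |(x : ℝ)| := by positivity
  have h1 : Real.exp 1 + |(x : ℝ)| ≤ Real.exp (1 + |(x : ℝ)|) := by
    rw [Real.exp_add]
    have he : 1 ≤ Real.exp 1 := Real.one_le_exp zero_le_one
    have ha : |(x : ℝ)| + 1 ≤ Real.exp |(x : ℝ)| := Real.add_one_le_exp _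
    nlinarith [abs_nonneg (x : ℝ), Real.exp_pos |(x : ℝ)|]
  calc Real.log (Real.exp 1 + |(x : ℝ)|) ≤ Real.log (Real.exp (1 + |(x : ℝ)|)) :=
        Real.log_le_log hpos h1
    _ = 1 + |(x : ℝ)| := Real.log_exp _

/-- **Superstable states are tempered in the sense of Lanford–Lebowitz–Lieb / Ruelle**: under
(2.3), `ω`-a.e. configuration has at most LINEAR growth of the positions, `|q_x| ≤ C_σ (1 + |x|)`
(indeed `(1+|q_x|)^{2s₁} ≤ C_σ log(e+|x|)`; linear growth is the uniqueness class of LLL 1977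
Thm 4 for `2s₁ = 4`). [folklore] -/
theorem ae_abs_fst_le_linear_of_hasSuperstabilityEstimate {s₁ s₂ : ℕ} (hs₁ : 1 ≤ s₁)
    (hs₂ : 1 ≤ s₂) (hU : IsEvenPolyOfDegree P.U s₁) (hV : IsEvenPolyOfDegree P.V s₂)
    {ω : Measure ChainConfig} (hω : P.HasSuperstabilityEstimate ω) :
    ∀ᵐ σ ∂ω, ∃ C : ℝ, 0 ≤ C ∧ ∀ x : ℤ, |(σ x).1| ≤ C * (1 + |(x : ℝ)|) := by
  filter_upwards [ae_logTempered_of_hasSuperstabilityEstimate hs₁ hs₂ hU hV hω] with σ hσ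
  obtain ⟨C, hC0, hC⟩ := hσ
  refine ⟨C, hC0, fun x => ?_⟩
  have h := (hC x).2
  have hlog := log_exp_add_abs_le x
  have hbase : 0 ≤ 1 + |(σ x).1| := by positivity
  -- `|q| ≤ (1+|q|)^{2s₁}` since `1 + |q| ≥ 1` and `2s₁ ≥ 1`
  have hpow : 1 + |(σ x).1| ≤ (1 + |(σ x).1|) ^ (2 * s₁) := by
    calc 1 + |(σ x).1| = (1 + |(σ x).1|) ^ 1 := (pow_one _).symm
      _ ≤ (1 + |(σ x).1|) ^ (2 * s₁) :=
          pow_le_pow_right₀ (by linarith [abs_nonneg (σ x).1]) (by omega)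
  calc |(σ x).1| ≤ 1 + |(σ x).1| := by linarith [abs_nonneg (σ x).1]
    _ ≤ (1 + |(σ x).1|) ^ (2 * s₁) := hpow
    _ ≤ C * Real.log (Real.exp 1 + |(x : ℝ)|) := h
    _ ≤ C * (1 + |(x : ℝ)|) := mul_le_mul_of_nonneg_left hlog hC0

/-- **The tree's pinned quartic chain**: every state of `pinnedChain ω₂ lam β γ` (`ω₂ ≥ 0`,
`lam > 0`, `β > 0`) with the superstability estimate (2.3) is carried by configurations with
`p_x²/2 + U(q_x) + 1 ≤ C_σ log(e+|x|)` and `(1+|q_x|)⁴ ≤ C_σ log(e+|x|)` for all `x`. [folklore] -/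
theorem ae_logTempered_of_hasSuperstabilityEstimate_pinnedChain {ω₂ lam β : ℝ} (γ : ℝ)
    (hω₂ : 0 ≤ ω₂) (hl : 0 < lam) (hβ : 0 < β) {ω : Measure ChainConfig}
    (hω : (pinnedChain ω₂ lam β γ).HasSuperstabilityEstimate ω) :
    ∀ᵐ σ ∂ω, ∃ C : ℝ, 0 ≤ C ∧ ∀ x : ℤ,
      (σ x).2 ^ 2 / 2 + (pinnedChain ω₂ lam β γ).U (σ x).1 + 1 ≤
          C * Real.log (Real.exp 1 + |(x : ℝ)|) ∧
      (1 + |(σ x).1|) ^ 4 ≤ C * Real.log (Real.exp 1 + |(x : ℝ)|) := by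
  have h := ae_logTempered_of_hasSuperstabilityEstimate (P := pinnedChain ω₂ lam β γ) (s₁ := 2)
    (s₂ := 2) (by norm_num) (by norm_num) (pinnedChain_isEvenPolyOfDegree_U β γ hω₂ hl)
    (pinnedChain_isEvenPolyOfDegree_V ω₂ lam γ hβ) hω
  simpa using h

/-- The pinned quartic chain: superstable states are carried by linearly tempered configurations,
`|q_x| ≤ C_σ (1 + |x|)`. [folklore] -/
theorem ae_abs_fst_le_linear_of_hasSuperstabilityEstimate_pinnedChain {ω₂ lam β : ℝ} (γ : ℝ)
    (hω₂ : 0 ≤ ω₂) (hl : 0 < lam) (hβ : 0 < β) {ω : Measure ChainConfig}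
    (hω : (pinnedChain ω₂ lam β γ).HasSuperstabilityEstimate ω) :
    ∀ᵐ σ ∂ω, ∃ C : ℝ, 0 ≤ C ∧ ∀ x : ℤ, |(σ x).1| ≤ C * (1 + |(x : ℝ)|) :=
  ae_abs_fst_le_linear_of_hasSuperstabilityEstimate (P := pinnedChain ω₂ lam β γ) (s₁ := 2)
    (s₂ := 2) (by norm_num) (by norm_num) (pinnedChain_isEvenPolyOfDegree_U β γ hω₂ hl)
    (pinnedChain_isEvenPolyOfDegree_V ω₂ lam γ hβ) hω

end OscillatorChain

end Literature.MathematicalPhysics.KineticTheory.HeatConduction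

end
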